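import Summits.BirchSwinnertonDyer.Rank1Residual.X11b.Three.KolyvaginShaThreeDescentToQ
import Summits.BirchSwinnertonDyer.Rank1Residual.X11b.BDPRouteOddPrime
import Summits.BirchSwinnertonDyer.Rank1Residual.X11b.BDPRouteOnTreeStepL
import Literature.NumberTheory.EllipticCurves.NeronIsogenyScalingHoldsProofs
import HarnessLib

/-!
# X11b @ 3 ∩ (KN₃)/ℚ: clause (ii) of `BSD(E, 3)` — `Ш(E/ℚ)[3^∞]` finite — with NO free `(K, y_K)`,
# from published named facts and the FOUR cite-only inputs {hrec, hCM₃, h53₃, hγ₃} (∀ K)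

Cell `b2b-bsdres`, team x11b3 (N8/O2); seat x11b3-p2 GEN 36 ((P2-QUANT) FILE E, the closed form of
FILE D `X11b/Three/KolyvaginShaThreeDescentToQ`).  Summit-side THEOREM-ONLY file (no definition,
no named fact, no `sorry`); the literal prime `3`.

HONEST FRAMING (binding): **plumbing — COMPOSITIONS of tree theorems, nothing discharged.**  Every
END of the lineage keeps `(K, P)` — an imaginary quadratic Heegner field and a NON-TORSION Heegner
point — as hypotheses of its conclusion.  For `(E, 3) ∈ ClassX11b W 3` (`r_an(E/ℚ) = 1`) the tree
already PRODUCES such data from published facts, exactly as the class theorem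
`bsdp_of_classX11b_three_of_onTreeInputs` does: `exists_oddHeegnerData` (`X11b/BDPRouteOddPrime`:
a Hoffstein–Luo field `K` with the Heegner hypothesis for `N_E`, `d_K` odd, `3 ∤ d_K`, `3 ∤ #𝓞_K^×`,
`L(E^{d_K}, 1) ≠ 0`, and the Heegner point `P = y_K` of a parametrisation datum — from
`exists_isNewformOf` (modularity), `HoffsteinLuo1997_exists_twist_L_one_ne_zero`,
`mazur_not_dvd_maninConstant_of_odd`, and the tree theorem
`integral_neronScaling_of_isGloballyMinimal_holds`) and
`not_isOfFinAddOrder_of_heegner_of_analyticRank_eq_one` (`X11b/BDPRouteOnTreeStepL`: `y_K`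
non-torsion from `gross_zagier` + `hasEntireLFunction_rat` + `r_an = 1` + `L(E^{d_K},1) ≠ 0`).
THIS FILE plugs that data into FILE D's
`Three.finite_primaryComponent_sha_three_of_classX11b_of_kodairaNeron_rat`: on `ClassX11b W 3` ∩
(KN₃)/ℚ, **`Finite (AddCommGroup.primaryComponent W.sha 3)`** — clause (ii) of Miller's `BSD(E,3)`
(`BSDp W 3`) TOKEN FOR TOKEN — ⟸ the published named facts {`gross_zagier` (∀ N W K),
`hasEntireLFunction_rat`, `exists_isNewformOf`, `HoffsteinLuo1997_exists_twist_L_one_ne_zero`,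
`mazur_not_dvd_maninConstant_of_odd`, `poitouTate_sum_localTatePairing_eq_zero` (∀ K)} + the FOUR
cite-only inputs {`hrec`, `hCM₃`, `h53₃`, `hγ₃`} quantified over EVERY number field `K : Type` at
`N = N_E` (FILE 6's binders VERBATIM with `N ↦ W.conductorNorm ℤ` under
`∀ (K : Type) [Field K] [NumberField K]`; used at ONE field) + (KN₃)/ℚ — and NO `(K, P)`
hypothesis.  In the class theorem this clause comes from the named fact
`rank_eq_analyticRank_of_analyticRank_le_one` (`hGZK`, Gross–Zagier–Kolyvagin over `ℚ` as a black
box); here its `Ш[3^∞]`-part on this class is traced to the Kolyvagin-side leaves instead.  The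
cite-only labels are NOT Literature facts and are NOT discharged; `hGZK`, `kolyvagin`,
`Kolyvagin1990_padicValNat_card_sha_le` are NOT discharged; clauses (i), (iii), (iv) of `BSDp W 3`
untouched; nothing booked; no mark / label / count / tier moves; node `Three.HsiehDescentAt₃` and
its FOUR antecedents untouched; #(KN₃) not asserted.

## References

* [HoffsteinLuo1997] Theorem (§1); [Mazur1978] Cor. 4.1; [GrossZagier1986] Thm. I.(6.3);
  [Gross1991] (1.1); [Miller2011LMS] Def. 1.1 (ii); [McCallumLMS1991] §1 Theorem (Kolyvagin);
  [SerreGaloisCohomology1997] I.§2.4.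

presearch: "clause (ii) of BSDp at 3 from Kolyvagin leaves" → tree `bsdp_of_classX11b_three_of_onTreeInputs`
takes it from `hGZK`; `lean search 'primaryComponent W.sha 3'` in X11b Kolyvagin files → none;
nothing minted.
-/

noncomputable section

open scoped Classical
open WeierstrassCurve Field NumberField IsDedekindDomain
open Literature.NumberTheory.EllipticCurves Literature.NumberTheory.GaloisRepresentations
open Literature.NumberTheory.EllipticCurves.Rank1Residual
open Literature.NumberTheory.EllipticCurves.RingClassField
open Literature.NumberTheory.EllipticCurves.ModularForms
open Literature.NumberTheory.DiophantineGeometry Literature.NumberTheory.DiophantineGeometry.TateAlgorithm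
open Summit.BirchSwinnertonDyer.Rank1Residual.X11b.KolyvaginAssembly

namespace Summit.BirchSwinnertonDyer.Rank1Residual.X11b.Three

variable {W : WeierstrassCurve ℚ}

/-- **On the class X11b @ 3 ∩ (KN₃)/ℚ, `Ш(E/ℚ)[3^∞]` is finite — clause (ii) of `BSD(E, 3)`
(`BSDp W 3`) VERBATIM — from published named facts and the FOUR cite-only inputs {`hrec`,
`hCM₃`, `h53₃`, `hγ₃`} (∀ `K`), with NO `(K, y_K)` hypothesis.**  Data: a Hoffstein–Luo Heegner
field `K` and the Heegner point `y_K` (`exists_oddHeegnerData`; `hnf`, `hHL`, `hMaz`), non-torsion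
by Gross–Zagier (`not_isOfFinAddOrder_of_heegner_of_analyticRank_eq_one`; `hGZ`, `hmod`,
`r_an = 1`); then FILE D's `finite_primaryComponent_sha_three_of_classX11b_of_kodairaNeron_rat` at
that `K` (labels specialised at `K`; `N = N_E`).  CONDITIONAL on EXACTLY {`hGZ`, `hmod`, `hnf`,
`hHL`, `hMaz`, `hPT`} (named facts) + {`hrec`, `hCM`, `h53`, `hγ`} at `3` for every `K` (cite-only,
NOT discharged) + (KN₃)/ℚ (`hKN3m`, `hKN3a`); nothing booked; no mark / count / tier moves.
[cite: Miller2011LMS, Def. 1.1 (ii)] [cite: HoffsteinLuo1997, Theorem (§1)] [cite: Gross1991, (1.1)]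
[cite: McCallumLMS1991, §1 Theorem (Kolyvagin)] -/
theorem finite_primaryComponent_sha_three_of_classX11b_of_kodairaNeron_of_facts [W.IsElliptic]
    [W.IsGloballyMinimal] [NeZero (W.conductorNorm ℤ)] (hX : ClassX11b W 3)
    -- published inputs (named facts of the tree)
    (hGZ : ∀ (N : ℕ) [NeZero N] (W : WeierstrassCurve ℚ) (K : Type) [Field K] [NumberField K],
      gross_zagier N W K)
    (hmod : hasEntireLFunction_rat) (hnf : exists_isNewformOf)
    (hHL : HoffsteinLuo1997_exists_twist_L_one_ne_zero) (hMaz : mazur_not_dvd_maninConstant_of_odd)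
    (hPT : ∀ (K : Type) [Field K] [NumberField K],
      Literature.NumberTheory.GaloisCohomology.poitouTate_sum_localTatePairing_eq_zero K)
    -- the cite-only inputs AT 3, for every number field `K` (used at ONE Hoffstein–Luo field)
    (hrec : ∀ (K : Type) [Field K] [NumberField K],
      heegnerPointOfConductor_one_galoisConj (W.conductorNorm ℤ) W K)
    (hCM : ∀ (K : Type) [Field K] [NumberField K],
      ∀ [W.IsElliptic] (_hK : IsImaginaryQuadratic K) (_hH : SatisfiesHeegnerHypothesis (W.conductorNorm ℤ) K)
      (Dt : ModularParametrizationData W (W.conductorNorm ℤ)) (β : ℤ) (ι : K →+* ℂ),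
      (4 * (W.conductorNorm ℤ) : ℤ) ∣ β ^ 2 - NumberField.discr K →
      ∀ {M : ℕ}, 1 ≤ M → ∀ (m : ℕ), Squarefree m →
      (∀ q ∈ m.primeFactors, IsKolyvaginPrime (W.conductorNorm ℤ) W K 3 q ∧ FrobEqFrobInfty W K (3 ^ M) q) →
      ∃ y : (W.baseChange (ringClassField K ι m)).toAffine.Point,
        WeierstrassCurve.Affine.Point.map (W' := W) (ringClassField K ι m).subtype.toRatAlgHom y =
          heegnerPointComplexOfConductor Dt (NumberField.discr K) β m)
    (h53 : ∀ (K : Type) [Field K] [NumberField K],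
      ∀ [W.IsElliptic] (_hK : IsImaginaryQuadratic K) (_hH : SatisfiesHeegnerHypothesis (W.conductorNorm ℤ) K)
      (Dt : ModularParametrizationData W (W.conductorNorm ℤ)) (β : ℤ) (ι : K →+* ℂ) {M : ℕ}
      (_hM : 1 ≤ M) {n : ℕ} (_hn : Squarefree n)
      (_hKol : ∀ q ∈ n.primeFactors, IsKolyvaginPrime (W.conductorNorm ℤ) W K 3 q ∧ FrobEqFrobInfty W K (3 ^ M) q)
      (d : (m : ℕ) → m ∣ n → KolyvaginHeegnerData Dt β ι m) (m : ℕ) (hm : m ∣ n)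
      (τm : ringClassField K ι m ≃ₐ[ℚ] ringClassField K ι m),
      (∀ x : ringClassField K ι m, ((τm x : ringClassField K ι m) : ℂ) = starRingEnd ℂ x) →
      ∃ σ' ∈ ringClassGal ι m, IsOfFinAddOrder
        (pointGalHom W (ringClassField K ι m) τm (d m hm).y -
          (-W.rootNumber) • pointGalHom W (ringClassField K ι m) σ' (d m hm).y))
    (hKN3m : ∀ [W.IsElliptic] (v : HeightOneSpectrum (𝓞 ℚ)),
      W.HasMultiplicativeReductionAt v → ¬ 3 ∣ W.ordMinimalDiscriminant v)
    (hKN3a : ∀ [W.IsElliptic] (v : HeightOneSpectrum (𝓞 ℚ)), W.HasAdditiveReductionAt v →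
      W.kodairaSymbolAt v ≠ KodairaSymbol.IV ∧ W.kodairaSymbolAt v ≠ KodairaSymbol.IVstar)
    (hγ : ∀ (K : Type) [Field K] [NumberField K],
      ∀ [W.IsElliptic] (_hK : IsImaginaryQuadratic K) (_hH : SatisfiesHeegnerHypothesis (W.conductorNorm ℤ) K)
      (Dt : ModularParametrizationData W (W.conductorNorm ℤ)) (β : ℤ) (ι : K →+* ℂ) {M : ℕ}
      (_hM : 1 ≤ M) {n : ℕ} (_hn : Squarefree n)
      (_hKol : ∀ q ∈ n.primeFactors, IsKolyvaginPrime (W.conductorNorm ℤ) W K 3 q ∧ FrobEqFrobInfty W K (3 ^ M) q)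
      (d : (m : ℕ) → m ∣ n → KolyvaginHeegnerData Dt β ι m)
      (m : ℕ) (hm : m ∣ n) (ℓ : ℕ) (hℓ : ℓ ∈ m.primeFactors) [Fact ℓ.Prime]
      (hΔ : ¬ (ℓ : ℤ) ∣ minimalDiscriminantInt W) (φ₀ : absoluteGaloisGroup (ZMod ℓ)),
      (∀ x : AlgebraicClosure (ZMod ℓ), φ₀ • x = x ^ ℓ) →
      ∀ (hle : ringClassField K ι (m / ℓ) ≤ ringClassField K ι m)
        (γ : ringClassField K ι m ≃ₐ[ℚ] ringClassField K ι m), γ ∈ ringClassGal ι m →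
        geomReduction hΔ ((RatClosure.pointsEquiv (K := K) W).symm
            ((d m hm).toGeomPoints (pointGalHom W (ringClassField K ι m) γ (d m hm).y))) =
          φ₀ • geomReduction hΔ ((RatClosure.pointsEquiv (K := K) W).symm
            ((d m hm).toGeomPoints (pointGalHom W (ringClassField K ι m) γ
              (WeierstrassCurve.Affine.Point.map (W' := W)
                ((RingClassField.inclusion ι hle).restrictScalars ℚ)
                (d (m / ℓ)
                  ((Nat.div_dvd_of_dvd (Nat.dvd_of_mem_primeFactors hℓ)).trans hm)).y))))) :
    Finite (AddCommGroup.primaryComponent W.sha 3) := by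
  obtain ⟨hr, -, hmult, hirr⟩ := id hX
  obtain ⟨K, _, _, Dt, H, ι, P, Wd, _, _, Cd, hK, hodd, hpd, hHN, hP, hc, hμ, hLt, hWd⟩ :=
    exists_oddHeegnerData hnf hHL hMaz integral_neronScaling_of_isGloballyMinimal_holds W 3 hr
      (by decide) hmult hirr
  have hPinf : ¬ IsOfFinAddOrder P :=
    not_isOfFinAddOrder_of_heegner_of_analyticRank_eq_one W _ K Dt H ι P (hGZ _ W K) hmod hr hK hHN
      hLt hP
  exact finite_primaryComponent_sha_three_of_classX11b_of_kodairaNeron_rat (N := W.conductorNorm ℤ)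
    hX (hPT K) (@fun _ ↦ rfl) (hrec K) (hCM K) (h53 K) hKN3m hKN3a (hγ K) hK hHN ⟨Dt, H, ι, hP⟩ hPinf

end Summit.BirchSwinnertonDyer.Rank1Residual.X11b.Three

end
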